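import Summits.PneNP.PneNP.Theorems.ConvexRankGatesLinAlgGateBlindLinRankLogWidth

/-!
# Route ConvexRankGates, crux `LinAlgGateBlind` (stmt-PneNP-10681): linear matroid intersection (Edmonds) for the MI door

Support lemmas for the matroid-intersection door (`…MatroidInterCover`, `…MatroidInterLogWidth`): the term gates
`[∃ I ⊆ live, #I = θ, (u_i)_{i ∈ I} and (w_i)_{i ∈ I} both independent]` — generic rank `≥ θ` of the rank-one pencil
`∑_{live i} X_i u_i w_iᵀ` (Edmonds 1967 / Lovász 1989), the common generalisation of the Kőnig, Hall-cover and rank-threshold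
gates of the tree. This file is the linear algebra:

* `matroidIntersection_rank` / `exists_common_independent_of_forall_cover` — MATROID INTERSECTION in rank form (Edmonds 1970): for normalised,
  unit-increase, monotone, submodular `r₁, r₂ : Finset ι → ℕ`, if `θ ≤ r₁ T + r₂ (E ∖ T)` for all `T ⊆ E` then `E` contains a
  common independent `θ`-set (`#I = θ = r₁ I = r₂ I`); Woodall/Welsh induction (delete or contract one element, submodularity);
* `exists_rankCover_of_no_common_independent` — the linear instance: no common independent `θ`-set among `E` ⇒ a split
  `T ⊆ E` with `dim span u(T) + dim span w(E ∖ T) < θ`;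
* `exists_tight_pair` — from a covering pair `(P₀, Q₀)` (`u_a ∈ P₀ ∨ w_a ∈ Q₀` on `E`) to a TIGHT one below it:
  `P = span {u_a : a ∈ E, w_a ∉ Q}`, `Q = span {w_a : a ∈ E, u_a ∉ P}` (two shrinking steps);
* `finrank_sup_span_singleton_eq`, `card_le_finrank_add_finrank_of_cover` — bookkeeping: adding a vector outside a subspace
  raises the dimension by one; a common independent set covered by `(P, Q)` has `≤ dim P + dim Q` elements.

Sources: J. Edmonds, Submodular functions, matroids, and certain polyhedra (1970), Thm. (69); D. J. A. Welsh, Matroid Theory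
(1976) §8.6; L. Lovász, Singular spaces of matrices and their application in combinatorics (1989) §2. No new definitions.
[folklore]
-/

-- `Summit.PneNP.PneNP.…` duplicates `PneNP` BY DESIGN (single-problem summit).
set_option linter.dupNamespace false

namespace Summit.PneNP.PneNP.Theorems

open Finset

/-- **Matroid intersection, rank form (Edmonds).** Let `r₁, r₂ : Finset ι → ℕ` be normalised, unit-increase, monotone and
submodular. If `θ ≤ r₁ T + r₂ (E \ T)` for every `T ⊆ E`, then `E` contains a common independent set of size `θ`: some
`I ⊆ E` with `#I = θ = r₁ I = r₂ I`. (Induction on `#E`, Woodall/Welsh: for `e ∈ E` either deleting `e` keeps the cover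
condition, or contracting `e` keeps it for `θ - 1`, since a bad set for each would contradict submodularity; loops are
deleted.) [folklore] -/
theorem matroidIntersection_rank {ι : Type*} [DecidableEq ι] :
    ∀ (n : ℕ) (r₁ r₂ : Finset ι → ℕ), r₁ ∅ = 0 → r₂ ∅ = 0 →
      (∀ e T, r₁ (insert e T) ≤ r₁ T + 1) → (∀ e T, r₂ (insert e T) ≤ r₂ T + 1) →
      (∀ S T, S ⊆ T → r₁ S ≤ r₁ T) → (∀ S T, S ⊆ T → r₂ S ≤ r₂ T) →
      (∀ S T, r₁ (S ∪ T) + r₁ (S ∩ T) ≤ r₁ S + r₁ T) → (∀ S T, r₂ (S ∪ T) + r₂ (S ∩ T) ≤ r₂ S + r₂ T) →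
      ∀ E : Finset ι, #E = n → ∀ θ : ℕ, (∀ T ⊆ E, θ ≤ r₁ T + r₂ (E \ T)) →
        ∃ I ⊆ E, #I = θ ∧ r₁ I = θ ∧ r₂ I = θ := by
  intro n
  induction n with
  | zero =>
    intro r₁ r₂ h01 h02 _ _ _ _ _ _ E hE θ hθ
    have hE0 : E = ∅ := card_eq_zero.1 hE
    subst hE0
    have h := hθ ∅ (empty_subset _)
    rw [empty_sdiff, h01, h02] at h
    refine ⟨∅, empty_subset _, ?_, ?_, ?_⟩ <;> simp_all
  | succ n ih =>
    intro r₁ r₂ h01 h02 h11 h12 h21 h22 h31 h32 E hE θ hθ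
    rcases Nat.eq_zero_or_pos θ with hθ0 | hθpos
    · exact ⟨∅, empty_subset _, by simp [hθ0], by simp [h01, hθ0], by simp [h02, hθ0]⟩
    obtain ⟨e, he⟩ : E.Nonempty := card_pos.1 (by omega)
    set E' := E.erase e with hE'
    have hE'card : #E' = n := by rw [hE', card_erase_of_mem he, hE]; rfl
    have hE'sub : E' ⊆ E := erase_subset e E
    have heE' : e ∉ E' := by simp [hE']
    -- single-element facts
    have hsing₁ : ∀ T, r₁ (insert e T) ≤ r₁ {e} + r₁ T := fun T => by
      have h := h31 {e} T
      rw [← insert_eq] at h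
      omega
    have hsing₂ : ∀ T, r₂ (insert e T) ≤ r₂ {e} + r₂ T := fun T => by
      have h := h32 {e} T
      rw [← insert_eq] at h
      omega
    have hr₁e : r₁ {e} ≤ 1 := by simpa [h01] using h11 e ∅
    have hr₂e : r₂ {e} ≤ 1 := by simpa [h02] using h12 e ∅
    -- two set identities around `e`
    have hF1 : ∀ T, E \ insert e T = E' \ T := fun T => by
      ext x
      simp only [mem_sdiff, mem_insert, hE', mem_erase, not_or]
      tauto
    have hF2 : ∀ T, e ∉ T → E \ T = insert e (E' \ T) := fun T heT => by
      ext x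
      simp only [mem_sdiff, mem_insert, hE', mem_erase]
      by_cases hx : x = e
      · subst hx
        simp [he, heT]
      · simp [hx]
    -- deletion keeps the cover condition in the loop cases
    have hdelete : (∀ T ⊆ E', θ ≤ r₁ T + r₂ (E' \ T)) → ∃ I ⊆ E, #I = θ ∧ r₁ I = θ ∧ r₂ I = θ := by
      intro hdel
      obtain ⟨I, hI, hcard, h1, h2⟩ := ih r₁ r₂ h01 h02 h11 h12 h21 h22 h31 h32 E' hE'card θ hdel
      exact ⟨I, hI.trans hE'sub, hcard, h1, h2⟩
    by_cases hloop : r₁ {e} = 0 ∨ r₂ {e} = 0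
    · refine hdelete fun T hT => ?_
      have heT : e ∉ T := fun h => heE' (hT h)
      rcases hloop with h0 | h0
      · have h := hθ (insert e T) (insert_subset he (hT.trans hE'sub))
        rw [hF1 T] at h
        have := hsing₁ T
        omega
      · have h := hθ T (hT.trans hE'sub)
        rw [hF2 T heT] at h
        have := hsing₂ (E' \ T)
        omega
    push Not at hloop
    have hr₁e1 : r₁ {e} = 1 := by omega
    have hr₂e1 : r₂ {e} = 1 := by omega
    by_cases hdelOK : ∀ T ⊆ E', θ ≤ r₁ T + r₂ (E' \ T)
    · exact hdelete hdelOK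
    push Not at hdelOK
    obtain ⟨T₁, hT₁, hT₁lt⟩ := hdelOK
    -- contraction by `e`
    have hge₁ : ∀ T, 1 ≤ r₁ (insert e T) := fun T =>
      hr₁e1 ▸ h21 {e} (insert e T) (singleton_subset_iff.2 (mem_insert_self e T))
    have hge₂ : ∀ T, 1 ≤ r₂ (insert e T) := fun T =>
      hr₂e1 ▸ h22 {e} (insert e T) (singleton_subset_iff.2 (mem_insert_self e T))
    set r₁' : Finset ι → ℕ := fun T => r₁ (insert e T) - 1 with hr₁'
    set r₂' : Finset ι → ℕ := fun T => r₂ (insert e T) - 1 with hr₂'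
    have h01' : r₁' ∅ = 0 := by simp [hr₁', hr₁e1]
    have h02' : r₂' ∅ = 0 := by simp [hr₂', hr₂e1]
    have h11' : ∀ a T, r₁' (insert a T) ≤ r₁' T + 1 := fun a T => by
      simp only [hr₁']
      have h := h11 a (insert e T)
      rw [insert_comm a e T] at h
      have := hge₁ T
      omega
    have h12' : ∀ a T, r₂' (insert a T) ≤ r₂' T + 1 := fun a T => by
      simp only [hr₂']
      have h := h12 a (insert e T)
      rw [insert_comm a e T] at h
      have := hge₂ T
      omega
    have h21' : ∀ S T, S ⊆ T → r₁' S ≤ r₁' T := fun S T hST => by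
      simp only [hr₁']
      have := h21 (insert e S) (insert e T) (insert_subset_insert e hST)
      omega
    have h22' : ∀ S T, S ⊆ T → r₂' S ≤ r₂' T := fun S T hST => by
      simp only [hr₂']
      have := h22 (insert e S) (insert e T) (insert_subset_insert e hST)
      omega
    have h31' : ∀ S T, r₁' (S ∪ T) + r₁' (S ∩ T) ≤ r₁' S + r₁' T := fun S T => by
      simp only [hr₁']
      have h := h31 (insert e S) (insert e T)
      rw [← insert_union_distrib, ← insert_inter_distrib] at h
      have := hge₁ (S ∪ T); have := hge₁ (S ∩ T); have := hge₁ S; have := hge₁ T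
      omega
    have h32' : ∀ S T, r₂' (S ∪ T) + r₂' (S ∩ T) ≤ r₂' S + r₂' T := fun S T => by
      simp only [hr₂']
      have h := h32 (insert e S) (insert e T)
      rw [← insert_union_distrib, ← insert_inter_distrib] at h
      have := hge₂ (S ∪ T); have := hge₂ (S ∩ T); have := hge₂ S; have := hge₂ T
      omega
    by_cases hconOK : ∀ T ⊆ E', θ - 1 ≤ r₁' T + r₂' (E' \ T)
    · obtain ⟨I', hI', hcard', h1', h2'⟩ :=
        ih r₁' r₂' h01' h02' h11' h12' h21' h22' h31' h32' E' hE'card (θ - 1) hconOK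
      have heI' : e ∉ I' := fun h => heE' (hI' h)
      simp only [hr₁', hr₂'] at h1' h2'
      have := hge₁ I'; have := hge₂ I'
      refine ⟨insert e I', insert_subset he (hI'.trans hE'sub), ?_, ?_, ?_⟩
      · rw [card_insert_of_notMem heI', hcard']; omega
      · omega
      · omega
    push Not at hconOK
    obtain ⟨T₂, hT₂, hT₂lt⟩ := hconOK
    simp only [hr₁', hr₂'] at hT₂lt
    have heT₁ : e ∉ T₁ := fun h => heE' (hT₁ h)
    have heT₂ : e ∉ T₂ := fun h => heE' (hT₂ h)
    rw [← hF2 T₂ heT₂] at hT₂lt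
    -- the cover condition at `insert e (T₁ ∪ T₂)` and at `T₁ ∩ T₂`
    have hA := hθ (insert e (T₁ ∪ T₂)) (insert_subset he ((union_subset hT₁ hT₂).trans hE'sub))
    have hB := hθ (T₁ ∩ T₂) (inter_subset_left.trans (hT₁.trans hE'sub))
    -- submodularity
    have hS₁ := h31 T₁ (insert e T₂)
    have hF5 : T₁ ∪ insert e T₂ = insert e (T₁ ∪ T₂) := by
      ext x; simp only [mem_union, mem_insert]; tauto
    have hF6 : T₁ ∩ insert e T₂ = T₁ ∩ T₂ := by
      ext x
      simp only [mem_inter, mem_insert]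
      constructor
      · rintro ⟨h1, h2 | h2⟩
        · exact absurd h1 (h2 ▸ heT₁)
        · exact ⟨h1, h2⟩
      · rintro ⟨h1, h2⟩
        exact ⟨h1, Or.inr h2⟩
    rw [hF5, hF6] at hS₁
    have hS₂ := h32 (E' \ T₁) (E \ T₂)
    have hF7 : E' \ T₁ ∪ E \ T₂ = E \ (T₁ ∩ T₂) := by
      ext x
      simp only [mem_union, mem_sdiff, hE', mem_erase, mem_inter]
      by_cases hx : x = e
      · subst hx
        simp [he, heT₂]
      · simp only [hx, ne_eq, not_false_eq_true, true_and]
        tauto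
    have hF8 : E' \ T₁ ∩ (E \ T₂) = E \ insert e (T₁ ∪ T₂) := by
      ext x
      simp only [mem_inter, mem_sdiff, hE', mem_erase, mem_insert, mem_union]
      tauto
    rw [hF7, hF8] at hS₂
    have := hge₁ T₂
    have := hge₂ (E' \ T₂)
    rw [← hF2 T₂ heT₂] at this
    omega

/-- **Matroid intersection, rank form — registered statement** (`matroidIntersection_rank` at `ι : Type`). [folklore] -/
theorem exists_common_independent_of_forall_cover : ∀ {ι : Type} [DecidableEq ι] (n : ℕ) (r₁ r₂ : Finset ι → ℕ),
    r₁ ∅ = 0 → r₂ ∅ = 0 → (∀ e T, r₁ (insert e T) ≤ r₁ T + 1) → (∀ e T, r₂ (insert e T) ≤ r₂ T + 1) →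
    (∀ S T, S ⊆ T → r₁ S ≤ r₁ T) → (∀ S T, S ⊆ T → r₂ S ≤ r₂ T) →
    (∀ S T, r₁ (S ∪ T) + r₁ (S ∩ T) ≤ r₁ S + r₁ T) → (∀ S T, r₂ (S ∪ T) + r₂ (S ∩ T) ≤ r₂ S + r₂ T) →
    ∀ E : Finset ι, #E = n → ∀ θ : ℕ, (∀ T ⊆ E, θ ≤ r₁ T + r₂ (E \ T)) → ∃ I ⊆ E, #I = θ ∧ r₁ I = θ ∧ r₂ I = θ := by
  intro ι _
  exact matroidIntersection_rank

section Linear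

variable {F V₁ V₂ ι : Type*} [DivisionRing F] [AddCommGroup V₁] [Module F V₁] [FiniteDimensional F V₁]
  [AddCommGroup V₂] [Module F V₂] [FiniteDimensional F V₂] [DecidableEq ι]

/-- The rank function `T ↦ dim span u(T)` of a vector configuration is normalised, unit-increase, monotone and submodular
(the rank axioms of a linear matroid). [folklore] -/
theorem rank_axioms_span_image (u : ι → V₁) :
    Module.finrank F (Submodule.span F (u '' ((∅ : Finset ι) : Set ι))) = 0 ∧
    (∀ (e : ι) (T : Finset ι), Module.finrank F (Submodule.span F (u '' ((insert e T : Finset ι) : Set ι))) ≤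
      Module.finrank F (Submodule.span F (u '' (T : Set ι))) + 1) ∧
    (∀ S T : Finset ι, S ⊆ T → Module.finrank F (Submodule.span F (u '' (S : Set ι))) ≤
      Module.finrank F (Submodule.span F (u '' (T : Set ι)))) ∧
    (∀ S T : Finset ι, Module.finrank F (Submodule.span F (u '' ((S ∪ T : Finset ι) : Set ι))) +
      Module.finrank F (Submodule.span F (u '' ((S ∩ T : Finset ι) : Set ι))) ≤
      Module.finrank F (Submodule.span F (u '' (S : Set ι))) + Module.finrank F (Submodule.span F (u '' (T : Set ι)))) := by
  refine ⟨by simp, fun e T => ?_, fun S T hST => ?_, fun S T => ?_⟩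
  · rw [coe_insert, Set.image_insert_eq, Submodule.span_insert]
    calc Module.finrank F ↥((F ∙ u e) ⊔ Submodule.span F (u '' (T : Set ι)))
        ≤ Module.finrank F (F ∙ u e) + Module.finrank F (Submodule.span F (u '' (T : Set ι))) :=
          Submodule.finrank_add_le_finrank_add_finrank _ _
      _ ≤ 1 + Module.finrank F (Submodule.span F (u '' (T : Set ι))) := by
          gcongr; exact (finrank_span_le_card ({u e} : Set V₁)).trans (by simp)
      _ = _ := by ring
  · exact Submodule.finrank_mono (Submodule.span_mono (Set.image_mono (by exact_mod_cast hST)))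
  · have hsup : Submodule.span F (u '' ((S ∪ T : Finset ι) : Set ι)) =
        Submodule.span F (u '' (S : Set ι)) ⊔ Submodule.span F (u '' (T : Set ι)) := by
      rw [coe_union, Set.image_union, Submodule.span_union]
    have hinf : Submodule.span F (u '' ((S ∩ T : Finset ι) : Set ι)) ≤
        Submodule.span F (u '' (S : Set ι)) ⊓ Submodule.span F (u '' (T : Set ι)) := by
      rw [coe_inter]
      exact le_inf (Submodule.span_mono (Set.image_mono Set.inter_subset_left))
        (Submodule.span_mono (Set.image_mono Set.inter_subset_right))
    rw [hsup]
    have h := Submodule.finrank_sup_add_finrank_inf_eq (Submodule.span F (u '' (S : Set ι)))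
      (Submodule.span F (u '' (T : Set ι)))
    have h2 := Submodule.finrank_mono hinf
    omega

/-- **Linear matroid intersection, covering form.** If no `I ⊆ E` with `#I = θ` has both `(u_i)_{i ∈ I}` and
`(w_i)_{i ∈ I}` spanning `θ` dimensions, then some split `T ⊆ E` has `dim span u(T) + dim span w(E ∖ T) < θ`
(`matroidIntersection_rank` with the two rank functions of `rank_axioms_span_image`). [folklore] -/
theorem exists_rankCover_of_no_common_independent (u : ι → V₁) (w : ι → V₂) (E : Finset ι) (θ : ℕ)
    (h : ¬ ∃ I ⊆ E, #I = θ ∧ Module.finrank F (Submodule.span F (u '' (I : Set ι))) = θ ∧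
      Module.finrank F (Submodule.span F (w '' (I : Set ι))) = θ) :
    ∃ T ⊆ E, Module.finrank F (Submodule.span F (u '' (T : Set ι))) +
      Module.finrank F (Submodule.span F (w '' ((E \ T : Finset ι) : Set ι))) < θ := by
  by_contra hno
  push Not at hno
  obtain ⟨h01, h11, h21, h31⟩ := rank_axioms_span_image (F := F) u
  obtain ⟨h02, h12, h22, h32⟩ := rank_axioms_span_image (F := F) w
  exact h (matroidIntersection_rank #E _ _ h01 h02 h11 h12 h21 h22 h31 h32 E rfl θ hno)

omit [FiniteDimensional F V₁] [FiniteDimensional F V₂] [DecidableEq ι] in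
/-- **Tightening a covering pair.** If every `a ∈ E` has `u_a ∈ P₀ ∨ w_a ∈ Q₀`, then with
`P := span {u_a : a ∈ E, w_a ∉ Q₀} ≤ P₀` and `Q := span {w_a : a ∈ E, u_a ∉ P} ≤ Q₀` every `a ∈ E` still has
`u_a ∈ P ∨ w_a ∈ Q`, and the pair is TIGHT: `P = span {u_a : a ∈ E, w_a ∉ Q}`, `Q = span {w_a : a ∈ E, u_a ∉ P}`.
[folklore] -/
theorem exists_tight_pair (u : ι → V₁) (w : ι → V₂) (E : Set ι) (P₀ : Submodule F V₁) (Q₀ : Submodule F V₂)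
    (h : ∀ a ∈ E, u a ∈ P₀ ∨ w a ∈ Q₀) :
    ∃ (P : Submodule F V₁) (Q : Submodule F V₂), P ≤ P₀ ∧ Q ≤ Q₀ ∧ (∀ a ∈ E, u a ∈ P ∨ w a ∈ Q) ∧
      P = Submodule.span F (u '' {a | a ∈ E ∧ w a ∉ Q}) ∧ Q = Submodule.span F (w '' {a | a ∈ E ∧ u a ∉ P}) := by
  set P : Submodule F V₁ := Submodule.span F (u '' {a | a ∈ E ∧ w a ∉ Q₀}) with hP
  set Q : Submodule F V₂ := Submodule.span F (w '' {a | a ∈ E ∧ u a ∉ P}) with hQ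
  have hPP₀ : P ≤ P₀ := by
    refine Submodule.span_le.2 ?_
    rintro _ ⟨a, ⟨haE, haQ⟩, rfl⟩
    exact (h a haE).resolve_right haQ
  have hPQ₀ : ∀ a ∈ E, u a ∈ P ∨ w a ∈ Q₀ := fun a ha => by
    by_cases hw : w a ∈ Q₀
    · exact Or.inr hw
    · exact Or.inl (Submodule.subset_span ⟨a, ⟨ha, hw⟩, rfl⟩)
  have hQQ₀ : Q ≤ Q₀ := by
    refine Submodule.span_le.2 ?_
    rintro _ ⟨a, ⟨haE, haP⟩, rfl⟩
    exact (hPQ₀ a haE).resolve_left haP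
  have hPQ : ∀ a ∈ E, u a ∈ P ∨ w a ∈ Q := fun a ha => by
    by_cases hu : u a ∈ P
    · exact Or.inl hu
    · exact Or.inr (Submodule.subset_span ⟨a, ⟨ha, hu⟩, rfl⟩)
  refine ⟨P, Q, hPP₀, hQQ₀, hPQ, le_antisymm ?_ ?_, rfl⟩
  · exact Submodule.span_mono (Set.image_mono fun a ⟨haE, haQ⟩ => ⟨haE, fun hw => haQ (hQQ₀ hw)⟩)
  · refine Submodule.span_le.2 ?_
    rintro _ ⟨a, ⟨haE, haQ⟩, rfl⟩
    exact (hPQ a haE).resolve_right haQ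

omit [FiniteDimensional F V₂] [DecidableEq ι] in
/-- Adding a vector outside a finite-dimensional subspace raises the dimension by exactly one. [folklore] -/
theorem finrank_sup_span_singleton_eq (P : Submodule F V₁) {x : V₁} (hx : x ∉ P) :
    Module.finrank F ↥(P ⊔ (F ∙ x)) = Module.finrank F P + 1 := by
  have hx0 : x ≠ 0 := fun h => hx (h ▸ P.zero_mem)
  have hinf : P ⊓ (F ∙ x) = ⊥ := by
    rw [eq_bot_iff]
    intro y ⟨hyP, hyx⟩
    obtain ⟨c, rfl⟩ := Submodule.mem_span_singleton.1 hyx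
    by_cases hc : c = 0
    · simp [hc]
    · exact absurd (by simpa [hc] using P.smul_mem c⁻¹ hyP : x ∈ P) hx
  have h := Submodule.finrank_sup_add_finrank_inf_eq P (F ∙ x)
  rw [hinf, finrank_bot, add_zero, finrank_span_singleton hx0] at h
  exact h

omit [FiniteDimensional F V₁] [FiniteDimensional F V₂] in
/-- **A common independent set covered by `(P, Q)` has at most `dim P + dim Q` elements**: if `(u_i)_{i ∈ I}` and
`(w_i)_{i ∈ I}` both span `#I` dimensions and every `i ∈ I` has `u_i ∈ P ∨ w_i ∈ Q`, then `#I ≤ dim P + dim Q` (split `I` by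
the side that covers; each part is independent inside its subspace). [folklore] -/
theorem card_le_finrank_add_finrank_of_cover (u : ι → V₁) (w : ι → V₂) (I : Finset ι) (P : Submodule F V₁)
    (Q : Submodule F V₂) [FiniteDimensional F P] [FiniteDimensional F Q]
    (hu : Module.finrank F (Submodule.span F (u '' (I : Set ι))) = #I)
    (hw : Module.finrank F (Submodule.span F (w '' (I : Set ι))) = #I)
    (hcov : ∀ i ∈ I, u i ∈ P ∨ w i ∈ Q) : #I ≤ Module.finrank F P + Module.finrank F Q := by
  classical
  set I₁ := I.filter fun i => u i ∈ P with hI₁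
  set I₂ := I.filter fun i => u i ∉ P with hI₂
  have hcard : #I₁ + #I₂ = #I := by
    rw [hI₁, hI₂]; exact card_filter_add_card_filter_not _
  have hIU : (I : Set ι) = (I₁ : Set ι) ∪ (I₂ : Set ι) := by
    rw [← coe_union, hI₁, hI₂, filter_union_filter_not_eq]
  -- `u`-side: `#I ≤ dim P + #I₂`
  have h1 : #I ≤ Module.finrank F P + #I₂ := by
    have hle : Submodule.span F (u '' (I : Set ι)) ≤ P ⊔ Submodule.span F (↑(I₂.image u) : Set V₁) := by
      rw [hIU, Set.image_union, Submodule.span_union, coe_image]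
      exact sup_le_sup_right (Submodule.span_le.2 (by rintro _ ⟨i, hi, rfl⟩; exact (mem_filter.1 hi).2)) _
    calc #I = Module.finrank F (Submodule.span F (u '' (I : Set ι))) := hu.symm
      _ ≤ Module.finrank F ↥(P ⊔ Submodule.span F (↑(I₂.image u) : Set V₁)) := Submodule.finrank_mono hle
      _ ≤ Module.finrank F P + Module.finrank F (Submodule.span F (↑(I₂.image u) : Set V₁)) :=
          Submodule.finrank_add_le_finrank_add_finrank _ _
      _ ≤ Module.finrank F P + #(I₂.image u) := by gcongr; exact finrank_span_finset_le_card _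
      _ ≤ Module.finrank F P + #I₂ := by gcongr; exact card_image_le
  -- `w`-side: `#I ≤ #I₁ + dim Q`
  have h2 : #I ≤ #I₁ + Module.finrank F Q := by
    have hle : Submodule.span F (w '' (I : Set ι)) ≤ Submodule.span F (↑(I₁.image w) : Set V₂) ⊔ Q := by
      rw [hIU, Set.image_union, Submodule.span_union, coe_image]
      refine sup_le_sup_left (Submodule.span_le.2 ?_) _
      rintro _ ⟨i, hi, rfl⟩
      have hi' := mem_filter.1 hi
      exact (hcov i hi'.1).resolve_left hi'.2
    calc #I = Module.finrank F (Submodule.span F (w '' (I : Set ι))) := hw.symm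
      _ ≤ Module.finrank F ↥(Submodule.span F (↑(I₁.image w) : Set V₂) ⊔ Q) := Submodule.finrank_mono hle
      _ ≤ Module.finrank F (Submodule.span F (↑(I₁.image w) : Set V₂)) + Module.finrank F Q :=
          Submodule.finrank_add_le_finrank_add_finrank _ _
      _ ≤ #(I₁.image w) + Module.finrank F Q := by gcongr; exact finrank_span_finset_le_card _
      _ ≤ #I₁ + Module.finrank F Q := by gcongr; exact card_image_le
  omega

end Linear

end Summit.PneNP.PneNP.Theorems
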